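import Literature.NumberTheory.ComplexMultiplication.CMOrderGorenstein
import HarnessLib

/-!
# The relative conductor `𝔣 = (S:T)` of over-orders `S ⊆ T` and its multiplicator ring (MARSEGLIA 2019 REMARK 5.2):
# `(S:T)` is the biggest `T`-ideal inside `S`; `((S:T):(S:T)) = T` when `S` is Gorenstein, and also when `SᵗT` is
# invertible in `T` (since `(S:T) = (SᵗT)ᵗ`)

Family `hodge`, lane `lit-hodgefound` (Track 2 foundations library; seat p15, row g26-#16), topic
`Literature/NumberTheory/ComplexMultiplication`, namespaces `Literature.NumberTheory.ComplexMultiplication.EndOrder`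
(§1, any order `𝔯 = endOrder ρ`) and `…CMTypeLattice` (§2, `𝔯 = endOrder (M_μ)` with trace duals as in
`CMOrderGorenstein`: `↑TS = traceDual ℤ ℚ ↑MS` says «`TS = Sᵗ`»).  THEOREMS ONLY: no definition, no instance, no named
fact (net Literature debt `0`).  Vocabulary: over-orders are idempotents `MS = MS·MS ≠ 0`, `MT`, with `S ⊆ T` written
`MS·MT = MT`; `(I:J) = I / J`; «`S` Gorenstein» is the reflexivity hypothesis of `CMOrderGorenstein`
(`∀ N ≠ 0, MS·N = N → MS/(MS/N) = N`); «`N` invertible in `T`» is `∃ N′, N·N′ = MT`.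

## Source, VERBATIM

S. Marseglia, *Computing the ideal class monoid of an order*, J. Lond. Math. Soc. (2) 101 (2020) 984–1007
[Marseglia2019] (arXiv:1805.09671, held `paper:arxiv-1805.09671`, chunk p0010): "… The natural choice is to take `T`
the smallest over-order of `S` with `S^tT` invertible in `T` and as `𝔣`, the colon ideal `(S:T)`, which is the biggest
fractional `T`-ideal in `S`.  Remark 5.2. Given orders `S ⊆ T`, let `𝔣 = (S:T)`. If `S` is Gorenstein then by Lemma 2.1
and Proposition 2.10 it follows that `(𝔣:𝔣) = (S:T(S:T)) = (S:(S:T)) = T`. If `S` is not Gorenstein then the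
multiplicator ring of `𝔣` might still be equal to `T`. This for example must be the case when `T = 𝒪_K`. The
multiplicator ring of `𝔣` can also be strictly bigger than `T`, as Example 5.3 shows. If we assume that `S^tT` is
invertible in `T`, as required in Proposition 5.1, then `(𝔣:𝔣) = T`, because `𝔣 = (S^tT)^t` and each ideal has the same
multiplicator ring as its trace dual."

## What is formalised

* §1: **`EndOrder.le_div_iff_le_of_mul_eq`** («`(S:T)` is the biggest fractional `T`-ideal in `S`»),
  **`div_self_div_eq_of_forall_div_div_eq`** (REMARK 5.2, Gorenstein case: `((S:T):(S:T)) = T`),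
  **`div_self_eq_of_exists_mul_eq`** (an ideal `N` invertible in the over-order `T` with `TN = N` has `(N:N) = T`).
* §2: **`CMTypeLattice.div_self_div_eq_of_exists_mul_mul_eq`** (REMARK 5.2, second case: `SᵗT` invertible in `T` ⟹
  `((S:T):(S:T)) = T`, via `(S:T) = (SᵗT)ᵗ` and `(Nᵗ:Nᵗ) = (N:N)`).
-/

noncomputable section

open scoped nonZeroDivisors NumberField
open NumberField Module FractionalIdeal
open Submodule (traceDual)

namespace Literature.NumberTheory.ComplexMultiplication

/-! ## §1 Every order `𝔯 = endOrder ρ` -/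

namespace EndOrder

variable {K : Type} [Field K] [NumberField K]
variable {ι : Type} [Fintype ι] [DecidableEq ι] [Nonempty ι] {ρ : K →ₐ[ℚ] Matrix ι ι ℚ}
variable [IsFractionRing (endOrder ρ) K]

omit [Nonempty ι] in
/-- **«`(S:T)` is the biggest fractional `T`-ideal in `S`»**: a `T`-ideal `J` (`TJ = J`, `T ≠ 0`) lies in `S` iff it
lies in `(S:T)`. [cite: Marseglia2019, §5 (before Remark 5.2), p. 10] -/
theorem le_div_iff_le_of_mul_eq {S T J : FractionalIdeal (endOrder ρ)⁰ K} (hT0 : T ≠ 0) (hTJ : T * J = J) :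
    J ≤ S / T ↔ J ≤ S := by
  rw [le_div_iff_mul_le hT0, mul_comm, hTJ]

/-- **REMARK 5.2, Gorenstein case: `((S:T):(S:T)) = (S : T(S:T)) = (S : (S:T)) = T`** for over-orders `S ⊆ T` with
`S` Gorenstein (reflexive: `(S:(S:N)) = N` for every `S`-ideal `N`; Lemma 2.1 and `T(S:T) = (S:T)`).
[cite: Marseglia2019, §5 Remark 5.2, p. 10; §2 Lemma 2.1 and Prop. 2.10, pp. 4–5] -/
theorem div_self_div_eq_of_forall_div_div_eq {MS MT : FractionalIdeal (endOrder ρ)⁰ K} (hSS : MS * MS = MS)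
    (hS0 : MS ≠ 0) (hTT : MT * MT = MT) (hT0 : MT ≠ 0) (hST : MS * MT = MT)
    (hG : ∀ N : FractionalIdeal (endOrder ρ)⁰ K, N ≠ 0 → MS * N = N → MS / (MS / N) = N) :
    MS / MT / (MS / MT) = MT := by
  have hF0 : MS / MT ≠ 0 := div_ne_zero_of_one_le (one_le_of_mul_self_eq hSS hS0) hT0
  calc MS / MT / (MS / MT) = MS / (MT * (MS / MT)) := (div_mul_eq_div_div_fractionalIdeal hT0 hF0).symm
    _ = MS / (MS / MT) := by rw [mul_div_eq_div_of_mul_self_eq hTT hT0]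
    _ = MT := hG MT hT0 hST

/-- **An ideal `N` invertible in the over-order `T` (`TN = N`, `N·N′ = T`) has multiplicator ring `(N:N) = T`**
(`T ⊆ (N:N)` and `(N:N) = (N:N)·NN′ ⊆ NN′ = T`; «each ideal has the same multiplicator ring as its trace dual» is
then applied to `N = SᵗT`). [cite: Marseglia2019, §5 Remark 5.2, p. 10; §2 Lemma 2.5 («`I` invertible in `R` ⟹
`R` is the multiplicator ring of `I`»), p. 5] -/
theorem div_self_eq_of_exists_mul_eq {MT N : FractionalIdeal (endOrder ρ)⁰ K} (hTT : MT * MT = MT) (hT0 : MT ≠ 0)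
    (hN0 : N ≠ 0) (hTN : MT * N = N) (hinv : ∃ N' : FractionalIdeal (endOrder ρ)⁰ K, N * N' = MT) : N / N = MT := by
  obtain ⟨N', hNN'⟩ := hinv
  have h1T : (1 : K) ∈ MT := FractionalIdeal.one_le.1 (one_le_of_mul_self_eq hTT hT0)
  refine le_antisymm ?_ ((le_div_iff_mul_le hN0).2 hTN.le)
  calc N / N ≤ N / N * MT := fun x hx ↦ by
          have h := mul_mem_mul hx h1T
          rwa [mul_one] at h
    _ = N / N * N * N' := by rw [← hNN', mul_assoc]
    _ ≤ N * N' := mul_le_mul' ((le_div_iff_mul_le hN0).1 le_rfl) le_rfl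
    _ = MT := hNN'

end EndOrder

/-! ## §2 The order `𝔯 = endOrder (M_μ)`: `(S:T) = (SᵗT)ᵗ` -/

namespace CMTypeLattice

variable {K : Type} [Field K] [NumberField K]
variable {ι : Type} [Fintype ι] [DecidableEq ι] [Nonempty ι] (μ : Basis ι ℚ K)
variable [IsFractionRing (endOrder (Algebra.leftMulMatrix μ)) K]

/-- **REMARK 5.2, second case: if `SᵗT` is invertible in `T` then `((S:T):(S:T)) = T`** («because `𝔣 = (SᵗT)ᵗ` and
each ideal has the same multiplicator ring as its trace dual»: `(S:T) = (SᵗT)ᵗ` by Lemma 2.3, `(Nᵗ:Nᵗ) = (N:N)`, and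
`(N:N) = T` for `N = SᵗT` invertible in `T`). [cite: Marseglia2019, §5 Remark 5.2, p. 10; §2 Lemma 2.3 («`(I:J) =
(IᵗJ)ᵗ`», «`(I:J) = (Jᵗ:Iᵗ)`»), p. 4] -/
theorem div_self_div_eq_of_exists_mul_mul_eq {MS TS MT : FractionalIdeal (endOrder (Algebra.leftMulMatrix μ))⁰ K}
    (hSS : MS * MS = MS) (hS0 : MS ≠ 0) (hTT : MT * MT = MT) (hT0 : MT ≠ 0)
    (hTS : (TS : Submodule (endOrder (Algebra.leftMulMatrix μ)) K) =
      traceDual ℤ ℚ (MS : Submodule (endOrder (Algebra.leftMulMatrix μ)) K))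
    (hinv : ∃ N' : FractionalIdeal (endOrder (Algebra.leftMulMatrix μ))⁰ K, TS * MT * N' = MT) :
    MS / MT / (MS / MT) = MT := by
  -- `TS ≠ 0`
  obtain ⟨T', hT'0, hT'⟩ := exists_coe_eq_traceDual μ hS0
  have hTT' : T' = TS := coeToSubmodule_inj.1 (hT'.trans hTS.symm)
  subst hTT'
  have hN0 : T' * MT ≠ 0 := EndOrder.fractionalIdeal_mul_ne_zero hT'0 hT0
  -- `(S:T) = (SᵗT)ᵗ`
  have hF : ((MS / MT : FractionalIdeal (endOrder (Algebra.leftMulMatrix μ))⁰ K) :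
      Submodule (endOrder (Algebra.leftMulMatrix μ)) K) =
        traceDual ℤ ℚ ((T' * MT : FractionalIdeal (endOrder (Algebra.leftMulMatrix μ))⁰ K) :
          Submodule (endOrder (Algebra.leftMulMatrix μ)) K) :=
    coe_div_eq_traceDual_mul μ hS0 hT0 hT'
  have hF0 : MS / MT ≠ 0 := EndOrder.div_ne_zero_of_one_le (EndOrder.one_le_of_mul_self_eq hSS hS0) hT0
  -- `(𝔣:𝔣) = (Nᵗ:Nᵗ) = (N:N) = T`
  rw [← div_eq_div_of_coe_eq_traceDual μ hN0 hN0 hF0 hF hF]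
  exact EndOrder.div_self_eq_of_exists_mul_eq hTT hT0 hN0 (by rw [mul_left_comm, hTT]) hinv

end CMTypeLattice

end Literature.NumberTheory.ComplexMultiplication
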